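import Mathlib.Analysis.Calculus.ContDiff.Bounds
import Literature.Analysis.FunctionSpaces.TorusMollifierAllOrders
import Literature.Analysis.FunctionSpaces.FlatTorusProofs
import Literature.Analysis.FunctionSpaces.SmoothCutoff
import Literature.Analysis.FunctionSpaces.TorusSpaceTimeCutoff
import HarnessLib

/-!
# Plateau cut-offs on the flat torus with bounds on all derivatives, and the all-orders
# Leibniz bound for products of many cut-offs

Analysis/FunctionSpaces support file (everything proved; no definitions, no named facts). Two
pieces of smooth-cut-off calculus in the shape consumed by multiscale constructions on
`T^d = (ℝ/ℤ)^d`, where a cut-off `χ_k` at step `k` is a product of cut-offs living at all the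
coarser scales `M_0 < M_1 < ⋯ < M_{k-1}` and must obey `‖∇ⁿχ_k‖_∞ ≲_n M_{k-1}ⁿ` with constants
independent of the number `k` of factors (M. P. Coiculescu, S. Palasek, Invent. Math. 244 (2025),
arXiv:2503.14699, Def. 3.4: "a cutoff function `χ_k` which is identically `1` in `Ω_{k-1}`,
identically `0` outside of `Ω̃_{k-1}`, and obeys `‖∇^m χ_k‖_{L^∞} ≲_m M_{k-1}^m`", the regions `Ω_{k-1}`,
`Ω̃_{k-1}` being intersections over all scales `m ≤ k-1` of neighbourhoods of the pipes of scale `m`,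
Def. 3.1):

* `norm_iteratedFDeriv_finset_prod_le_pow` — **all-orders Leibniz for many factors**: if each
  `f_i : E → ℝ` (`i ∈ s`) is `Cⁿ`, `|f_i| ≤ 1`, and `‖Dᵃ f_i‖ ≤ L_iᵃ` for `1 ≤ a ≤ n`, then
  `|∏_{i∈s} f_i| ≤ 1` and `‖Dᵃ ∏_{i∈s} f_i‖ ≤ (∑_{i∈s} L_i)ᵃ` for all `a ≤ n` — by induction on `s`
  with the two-factor rule `‖Dᵃ(fg)‖ ≤ ∑_b (a choose b) ‖Dᵇf‖ ‖D^{a-b}g‖` (Mathlib's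
  `norm_iteratedFDeriv_mul_le`) and the binomial theorem; the point is that no constant depending
  on the number of factors appears (Evans, *PDE*, App. C / folklore multinomial Leibniz);
* `Torus.exists_plateau_cutoff` — **plateau cut-offs at scale `δ` with all derivatives
  controlled**: for `S ⊆ T^d` and `0 < δ ≤ 1/4` there is a smooth `χ : T^d → [0,1]` with `χ = 1` on
  the `δ`-neighbourhood `Metric.thickening δ S`, `χ = 0` off the `5δ`-neighbourhood, and
  `‖Dⁿ(χ∘proj)‖ ≤ c_n δ⁻ⁿ` for ALL `n`, with the explicit constants `c_n = Torus.derivProfileMass d n`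
  of the standard mollifier (Evans, App. C.4 Thm. 7: mollify a rough cut-off once more,
  `Dⁿ(ρ_δ ⋆ χ₀) = (Dⁿρ_δ) ⋆ χ₀`). Construction: De Rosa–Isett's periodic cut-off `χ₀` of the lifted
  `3δ`-neighbourhood at scale `δ` (`exists_smooth_cutoff_periodic`, first derivatives only),
  descended to `T^d` and mollified by `Torus.kernel δ`; the all-orders bounds are
  `Torus.norm_iteratedFDeriv_lift_kernel_convolution_le_of_forall_le`.

## Mathlib / tree search

Mathlib: `norm_iteratedFDeriv_mul_le`, `norm_iteratedFDeriv_prod_le` (multinomial form, not the power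
form needed here), `add_pow`, `Metric.thickening`, `thickening_thickening_subset`. Tree:
`exists_smooth_cutoff_periodic` (`FunctionSpaces/SmoothCutoff`), `Torus.kernel`,
`Torus.norm_iteratedFDeriv_lift_kernel_convolution_le_of_forall_le`, `Torus.norm_kernel_convolution_le`,
`Torus.kernel_eq_zero_of_le`, `Torus.integral_kernel` (`TorusMollifier`, `TorusMollifierAllOrders`),
`Torus.descend`, `Torus.lift_descend_holds` (`FlatTorus(Proofs)`), `Torus.exists_spaceTime_cutoff`,
`Torus.dist_proj_proj_le` (`TorusSpaceTimeCutoff`: first derivatives only, space–time). `lean search 'plateau|exists_cutoff.*iteratedFDeriv'`: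
no all-orders spatial cut-off on `T^d` prior to this file.

## References

* L. C. Evans, *Partial Differential Equations*, 2nd ed., AMS 2010, App. C.4 Thm. 7 (mollifiers),
  §5.3 (Leibniz formula). [Evans2010]
* M. P. Coiculescu, S. Palasek, Invent. Math. 244 (2025) 165–219, arXiv:2503.14699, Def. 3.1, Def. 3.4
  (the cut-offs `χ_k`). [CoiculescuPalasek2025]
-/

noncomputable section

open Set Metric Function MeasureTheory Filter
open scoped BigOperators ContDiff Convolution Topology

namespace Literature.Analysis.FunctionSpaces

/-! ## All-orders Leibniz bound for products of many factors -/

section ProdLeibniz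

variable {E : Type*} [NormedAddCommGroup E] [NormedSpace ℝ E]

/-- **Two factors, power form.** If `‖Dᵇ f(x)‖ ≤ Lᵇ` and `‖Dᵇ g(x)‖ ≤ Sᵇ` for all `b ≤ n`
(`L ≥ 0`, `f, g` of class `Cⁿ`), then `‖Dᵃ(fg)(x)‖ ≤ (L + S)ᵃ` for `a ≤ n` (Leibniz rule and the
binomial theorem). [folklore] -/
theorem norm_iteratedFDeriv_mul_le_add_pow {f g : E → ℝ} {n : ℕ} (hf : ContDiff ℝ n f)
    (hg : ContDiff ℝ n g) {L S : ℝ} (hL : 0 ≤ L) (x : E)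
    (hfb : ∀ b ≤ n, ‖iteratedFDeriv ℝ b f x‖ ≤ L ^ b) (hgb : ∀ b ≤ n, ‖iteratedFDeriv ℝ b g x‖ ≤ S ^ b)
    {a : ℕ} (ha : a ≤ n) :
    ‖iteratedFDeriv ℝ a (fun y => f y * g y) x‖ ≤ (L + S) ^ a := by
  have h := norm_iteratedFDeriv_mul_le hf hg x (n := a) (by exact_mod_cast ha)
  have hsum : ∑ b ∈ Finset.range (a + 1),
      (a.choose b : ℝ) * ‖iteratedFDeriv ℝ b f x‖ * ‖iteratedFDeriv ℝ (a - b) g x‖ ≤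
      ∑ b ∈ Finset.range (a + 1), (a.choose b : ℝ) * L ^ b * S ^ (a - b) := by
    refine Finset.sum_le_sum fun b hb => ?_
    have hba : b ≤ a := Nat.lt_succ_iff.1 (Finset.mem_range.1 hb)
    have h1 := hfb b (hba.trans ha)
    have h2 := hgb (a - b) ((Nat.sub_le a b).trans ha)
    gcongr
  have heq : ∑ b ∈ Finset.range (a + 1), (a.choose b : ℝ) * L ^ b * S ^ (a - b) = (L + S) ^ a := by
    rw [add_pow]
    exact Finset.sum_congr rfl fun b _ => by ring
  exact h.trans (hsum.trans_eq heq)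

/-- **All-orders Leibniz bound for a product of many factors, power form.** Let `f_i : E → ℝ`
(`i ∈ s`) be `Cⁿ` with `|f_i| ≤ 1` and `‖Dᵃ f_i‖ ≤ L_iᵃ` pointwise for `1 ≤ a ≤ n` (`L_i ≥ 0`). Then
`|∏_{i∈s} f_i| ≤ 1` and `‖Dᵃ(∏_{i∈s} f_i)(x)‖ ≤ (∑_{i∈s} L_i)ᵃ` for every `a ≤ n` and every `x` — with
NO constant depending on the number of factors (induction on `s` with the two-factor power form).
This is the bookkeeping behind "`‖∇^mχ_k‖_{L^∞} ≲_m M_{k-1}^m`" for cut-offs `χ_k = ∏_{m<k} ζ_m(M_m ·)`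
at lacunary scales (`∑_{m<k} M_m ≤ 2M_{k-1}`). [folklore] -/
theorem norm_iteratedFDeriv_finset_prod_le_pow {ι : Type*} [DecidableEq ι] (s : Finset ι)
    {f : ι → E → ℝ} {L : ι → ℝ} {n : ℕ} (hf : ∀ i ∈ s, ContDiff ℝ n (f i))
    (h1 : ∀ i ∈ s, ∀ x, ‖f i x‖ ≤ 1) (hL : ∀ i ∈ s, 0 ≤ L i)
    (hD : ∀ i ∈ s, ∀ a, 1 ≤ a → a ≤ n → ∀ x, ‖iteratedFDeriv ℝ a (f i) x‖ ≤ L i ^ a) :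
    ∀ a ≤ n, ∀ x, ‖iteratedFDeriv ℝ a (fun y => ∏ i ∈ s, f i y) x‖ ≤ (∑ i ∈ s, L i) ^ a := by
  induction s using Finset.induction_on with
  | empty =>
    intro a ha x
    simp only [Finset.prod_empty, Finset.sum_empty]
    rcases Nat.eq_zero_or_pos a with rfl | hpos
    · simp
    · rw [iteratedFDeriv_const_of_ne hpos.ne' (1 : ℝ), Pi.zero_apply, norm_zero]
      positivity
  | insert i s hi ih =>
    intro a ha x
    have hfi : ContDiff ℝ n (f i) := hf i (Finset.mem_insert_self i s)
    have hfs : ∀ j ∈ s, ContDiff ℝ n (f j) := fun j hj => hf j (Finset.mem_insert_of_mem hj)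
    have hG : ContDiff ℝ n fun y => ∏ j ∈ s, f j y := contDiff_prod hfs
    have ih' := ih hfs (fun j hj => h1 j (Finset.mem_insert_of_mem hj))
      (fun j hj => hL j (Finset.mem_insert_of_mem hj)) (fun j hj => hD j (Finset.mem_insert_of_mem hj))
    have hLi : 0 ≤ L i := hL i (Finset.mem_insert_self i s)
    simp only [Finset.prod_insert hi, Finset.sum_insert hi]
    refine norm_iteratedFDeriv_mul_le_add_pow hfi hG hLi x (fun b hb => ?_) (fun b hb => ih' b hb x) ha
    rcases Nat.eq_zero_or_pos b with rfl | hpos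
    · rw [norm_iteratedFDeriv_zero, pow_zero]
      exact h1 i (Finset.mem_insert_self i s) x
    · exact hD i (Finset.mem_insert_self i s) b hpos hb x

/-- The product of `[ -1, 1]`-bounded factors is `[-1,1]`-bounded (order zero of the previous
statement, recorded separately). [folklore] -/
theorem norm_finset_prod_le_one {X ι : Type*} (s : Finset ι) {f : ι → X → ℝ}
    (h1 : ∀ i ∈ s, ∀ x, ‖f i x‖ ≤ 1) (x : X) : ‖∏ i ∈ s, f i x‖ ≤ 1 := by
  classical
  induction s using Finset.induction_on with
  | empty => simp
  | insert i s hi ih =>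
    rw [Finset.prod_insert hi, norm_mul]
    have h := ih fun j hj => h1 j (Finset.mem_insert_of_mem hj)
    have h' := h1 i (Finset.mem_insert_self i s) x
    calc ‖f i x‖ * ‖∏ j ∈ s, f j x‖ ≤ 1 * 1 := by
          gcongr
      _ = 1 := one_mul 1

end ProdLeibniz

/-! ## Plateau cut-offs on `T^d` with all derivatives controlled -/

namespace Torus

variable {d : Type*} [Fintype d] [DecidableEq d]

omit [DecidableEq d] in
/-- A mollification of a `[0,1]`-valued function by the (nonnegative, unit-mass) torus kernel is
`[0,1]`-valued. [folklore] -/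
theorem kernel_convolution_mem_Icc {ε : ℝ} (hε : 0 < ε) (hε' : ε ≤ 1 / 4) {g : UnitAddTorus d → ℝ}
    (hg : ∀ x, 0 ≤ g x ∧ g x ≤ 1) (x : UnitAddTorus d) :
    0 ≤ (kernel ε ⋆ g) x ∧ (kernel ε ⋆ g) x ≤ 1 := by
  refine ⟨?_, ?_⟩
  · rw [convolution_lsmul]
    exact integral_nonneg fun y => smul_nonneg (kernel_nonneg hε.le y) (hg _).1
  · have h := norm_kernel_convolution_le (d := d) hε hε' (k := g) (A := 1)
      (fun y => by rw [Real.norm_eq_abs, abs_le]; exact ⟨by linarith [(hg y).1], (hg y).2⟩) x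
    rw [Real.norm_eq_abs] at h
    exact (le_abs_self _).trans h

omit [DecidableEq d] in
/-- If `g = c` on the `ε`-ball around `x` then `(kernel ε ⋆ g)(x) = c` (the kernel is supported in
`{‖z‖ < ε}` and has unit mass). [folklore] -/
theorem kernel_convolution_eq_of_forall_dist_lt {ε : ℝ} (hε : 0 < ε) (hε' : ε ≤ 1 / 4)
    {g : UnitAddTorus d → ℝ} {x : UnitAddTorus d} {c : ℝ} (hg : ∀ y, dist y x < ε → g y = c) :
    (kernel ε ⋆ g) x = c := by
  rw [convolution_lsmul]
  have hpt : ∀ t : UnitAddTorus d, kernel ε t • g (x - t) = kernel ε t • c := by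
    intro t
    by_cases ht : ε ≤ ‖t‖
    · rw [kernel_eq_zero_of_le hε ht, zero_smul, zero_smul]
    · rw [hg (x - t) (by rw [dist_eq_norm, sub_sub_cancel_left, norm_neg]; exact not_le.1 ht)]
  simp_rw [hpt, smul_eq_mul]
  rw [integral_mul_const, integral_kernel hε hε', one_mul]

/-- **Plateau cut-offs on `T^d` with all derivatives controlled.** For every `S ⊆ T^d` and
`0 < δ ≤ 1/4` there is `χ : T^d → ℝ`, smooth, `[0,1]`-valued, with `χ = 1` on the open
`δ`-neighbourhood `thickening δ S` of `S`, `χ = 0` off `thickening (5δ) S`, and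
`‖Dⁿ(χ ∘ proj)(y)‖ ≤ c_n δ⁻ⁿ` for all `n` and `y`, `c_n = Torus.derivProfileMass d n` (the mass of the
`n`-th derivative of the fixed unit bump; in particular `c_0 = 1`). Construction: mollify at scale
`δ`, by the torus kernel, a smooth periodic cut-off equal to `1` on `thickening (2δ) S` and to `0` off
`thickening (4δ) S`. (Evans, App. C.4 Thm. 7; used for the cut-offs `χ_k` of Coiculescu–Palasek, Def. 3.4.)
[cite: Evans2010, App. C.4 Thm. 7] -/
theorem exists_plateau_cutoff (S : Set (UnitAddTorus d)) {δ : ℝ} (hδ : 0 < δ) (hδ' : δ ≤ 1 / 4) :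
    ∃ χ : UnitAddTorus d → ℝ, IsSmooth χ ∧ (∀ x, 0 ≤ χ x ∧ χ x ≤ 1) ∧
      (∀ x ∈ thickening δ S, χ x = 1) ∧ (∀ x ∉ thickening (5 * δ) S, χ x = 0) ∧
      ∀ (n : ℕ) (y : EuclideanSpace ℝ d),
        ‖iteratedFDeriv ℝ n (lift χ) y‖ ≤ derivProfileMass d n * (δ ^ n)⁻¹ := by
  -- Step 1: a periodic smooth cut-off `χ₁` on `ℝ^d` adapted to the lifted `3δ`-neighbourhood
  obtain ⟨C, -, hC⟩ := exists_smooth_cutoff_periodic (volume : Measure (EuclideanSpace ℝ d))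
  set A : Set (EuclideanSpace ℝ d) := proj ⁻¹' thickening (3 * δ) S with hA
  have hAm : MeasurableSet A := (isOpen_thickening.preimage continuous_proj).measurableSet
  obtain ⟨χ₁, hχ₁s, hχ₁01, hχ₁1, hχ₁0, -, hχ₁p⟩ := hC A hAm δ hδ
  -- periodicity under the lattice
  have hper : IsLatticePeriodic χ₁ := by
    intro j x
    refine hχ₁p (EuclideanSpace.single j (1 : ℝ)) (fun w => ?_) x
    simp only [hA, mem_preimage]
    rw [← latticeVec_single, proj_add_latticeVec]
  -- Step 2: descend to the torus
  set χ₂ : UnitAddTorus d → ℝ := descend χ₁ hper with hχ₂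
  have hlift : lift χ₂ = χ₁ := lift_descend_holds χ₁ hper
  have hχ₂s : IsSmooth χ₂ := by
    show ContDiff ℝ ∞ (lift χ₂)
    rw [hlift]; exact hχ₁s
  have hχ₂01 : ∀ x, 0 ≤ χ₂ x ∧ χ₂ x ≤ 1 := fun x => hχ₁01 _
  have hχ₂1 : ∀ x ∈ thickening (2 * δ) S, χ₂ x = 1 := by
    intro x hx
    have hx' : proj (repr x) ∈ thickening (2 * δ) S := by rwa [proj_repr]
    refine hχ₁1 (repr x) fun z hz => ?_
    simp only [hA, mem_preimage]
    have h1 : dist (proj z) (proj (repr x)) < δ := (dist_proj_proj_le _ _).trans_lt (mem_ball_iff_norm.1 hz)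
    have h2 := thickening_thickening_subset δ (2 * δ) S
      (mem_thickening_iff.2 ⟨proj (repr x), hx', h1⟩)
    rwa [show δ + 2 * δ = 3 * δ by ring] at h2
  have hχ₂0 : ∀ x ∉ thickening (4 * δ) S, χ₂ x = 0 := by
    intro x hx
    refine hχ₁0 (repr x) (disjoint_left.2 fun z hz hzA => hx ?_)
    simp only [hA, mem_preimage] at hzA
    have h1 : dist (proj (repr x)) (proj z) < δ := by
      rw [dist_comm]; exact (dist_proj_proj_le _ _).trans_lt (mem_ball_iff_norm.1 hz)
    rw [proj_repr] at h1
    have h2 := thickening_thickening_subset δ (3 * δ) S (mem_thickening_iff.2 ⟨proj z, hzA, h1⟩)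
    rwa [show δ + 3 * δ = 4 * δ by ring] at h2
  -- Step 3: mollify at scale `δ`
  refine ⟨kernel δ ⋆ χ₂, isSmooth_convolution (isSmooth_kernel hδ hδ').integrable hχ₂s,
    kernel_convolution_mem_Icc hδ hδ' hχ₂01, fun x hx => ?_, fun x hx => ?_, fun n y => ?_⟩
  · -- `= 1` on `thickening δ S`: there `χ₂ = 1` on the whole `δ`-ball
    refine kernel_convolution_eq_of_forall_dist_lt hδ hδ' fun y hy => hχ₂1 y ?_
    have h2 := thickening_thickening_subset δ δ S (mem_thickening_iff.2 ⟨x, hx, hy⟩)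
    rwa [show δ + δ = 2 * δ by ring] at h2
  · -- `= 0` off `thickening (5δ) S`: there `χ₂ = 0` on the whole `δ`-ball
    refine kernel_convolution_eq_of_forall_dist_lt hδ hδ' fun y hy => hχ₂0 y fun hy' => hx ?_
    have h1 : dist x y < δ := by rw [dist_comm]; exact hy
    have h2 := thickening_thickening_subset δ (4 * δ) S (mem_thickening_iff.2 ⟨y, hy', h1⟩)
    rwa [show δ + 4 * δ = 5 * δ by ring] at h2
  · -- all derivatives fall on the kernel
    have h := norm_iteratedFDeriv_lift_kernel_convolution_le_of_forall_le hδ hδ' hχ₂s n y (A := 1)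
      fun z => by rw [Real.norm_eq_abs, abs_le]; exact ⟨by linarith [(hχ₂01 z).1], (hχ₂01 z).2⟩
    simpa using h

end Torus

end Literature.Analysis.FunctionSpaces
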